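import Literature.AlgebraicGeometry.Frobenioids.PadicKummerRelCosetGaloisFields
import HarnessLib

/-!
# Frobenioids II, §2 p. 17 / Thm. 2.4 p. 20: "`Gᵢ = Gal(K̄ᵢ/Kᵢ)`" — the absolute Galois group of `K = ℚ̄_p^G` IS `G = Im(Π)`,
# as TOPOLOGICAL groups (Krull), through the identification `K̄ ≅ ℚ̄_p`

Mochizuki, *The geometry of Frobenioids II*, Kyushu J. Math. **62** (2008) 401–460, §2 p. 17
[cite: MochizukiFrdII2008, Def 2.2 p.17]: "`G := Im(Π) ⊆ Q`; … `K` for the finite extension of `ℚ_p` determined by the open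
subgroup `G ⊆ Q`"; proof of Theorem 2.4 (ii) p. 20 [cite: MochizukiFrdII2008, Thm 2.4 (ii) p.20]: "write `Kᵢ` for the finite
extension of `ℚ_p` … determined by the open subgroup `Gᵢ ⊆ Qᵢ`, `K̄ᵢ` for the algebraic closure of `Kᵢ` used to define the
Galois group `Qᵢ` [so `Gᵢ = Gal(K̄ᵢ/Kᵢ)`]".

Definitions file (seat abc-iut-L1-t7, gen 5; binders of `thm24i_ofFunctorRel`, successor residual of GAP row G-L1t7-α). The
Definition 2.2 context of abc-iut-L1-t7's Galois binding reads `G` as Mathlib's `Field.absoluteGaloisGroup K = Gal(K̄/K)`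
(`K̄ = AlgebraicClosure K`), while print's `G = Im(Π)` lives inside `G_{ℚ_p} = Gal(ℚ̄_p/ℚ_p)`. This file supplies the
identification AS TOPOLOGICAL GROUPS, in general and for `K = ℚ̄_p^{Im(Π)}`:
* (classical, any tower `F ⊆ K₀ ⊆ Ω`, `K₀/F` finite, `ι : K̄₀ ≅ Ω` over `K₀`) `GaloisConj.continuous_autCongr` — conjugation
  by an isomorphism of extensions is Krull-continuous; `continuous_restrictScalarsHom` — `Gal(Ω/K₀) → Gal(Ω/F)` is
  Krull-continuous; `galConj K₀ ι : absoluteGaloisGroup K₀ ≃ₜ* ↥(K₀.fixingSubgroup)`, `σ ↦ ι σ ι⁻¹` (a continuous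
  bijection from a compact group onto a Hausdorff one), with its values `coe_galConj_apply`;
* (§2) `RelGal.galConjBase : absoluteGaloisGroup (ℚ̄_p^{Im Π}) ≃ₜ* ↥(Gal(ℚ̄_p/K))` through `closureEquiv`, with
  `Gal(ℚ̄_p/K) = Im(Π)` on members (`mem_fixingSubgroup_baseFld_iff`) — "`G = Gal(K̄/K)`".
Classical (Krull topology, Mathlib `krullTopology_mem_nhds_one_iff`, `Continuous.homeoOfEquivCompactToT2`); nothing here
concerns [IUTchIII]; no statement of the paper is strengthened.
-/

noncomputable section

namespace Literature.AlgebraicGeometry.Frobenioids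

namespace GaloisConj

open Field IntermediateField Topology

/-! ### Krull-continuity of conjugation and of restriction of scalars -/

/-- **Conjugation by an isomorphism of extensions `ι : L ≅ L'` over `K`, `σ ↦ ι σ ι⁻¹`, is continuous** for the Krull
topologies (`Gal(L'/E)` pulls back to `Gal(L/ι⁻¹E)`). [cite: MochizukiFrdII2008, Thm 2.4 (ii) p.20] -/
theorem continuous_autCongr {K L L' : Type*} [Field K] [Field L] [Field L'] [Algebra K L] [Algebra K L']
    (ι : L ≃ₐ[K] L') : Continuous (AlgEquiv.autCongr ι : (L ≃ₐ[K] L) → (L' ≃ₐ[K] L')) := by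
  apply continuous_of_continuousAt_one (AlgEquiv.autCongr ι)
  rw [ContinuousAt, map_one]
  refine Filter.tendsto_def.mpr fun s hs => ?_
  obtain ⟨E, hE, hEs⟩ := (krullTopology_mem_nhds_one_iff K L' s).mp hs
  haveI := hE
  refine (krullTopology_mem_nhds_one_iff K L _).mpr ⟨E.map ι.symm.toAlgHom, ?_, ?_⟩
  · exact LinearEquiv.finiteDimensional (intermediateFieldMap ι.symm E).toLinearEquiv
  · intro σ hσ
    apply hEs
    rw [SetLike.mem_coe, IntermediateField.mem_fixingSubgroup_iff] at hσ ⊢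
    intro x hx
    have hx' : ι.symm x ∈ E.map ι.symm.toAlgHom := ⟨x, hx, rfl⟩
    rw [AlgEquiv.autCongr_apply, AlgEquiv.trans_apply, AlgEquiv.trans_apply, hσ _ hx', AlgEquiv.apply_symm_apply]

variable {F : Type*} [Field F] {Ω : Type*} [Field Ω] [Algebra F Ω]

/-- An intermediate field `E ⊇ K₀` of `Ω/F` finite over `F` is finite over `K₀`.
[cite: MochizukiFrdII2008, Rmk 2.2.1 p.18] -/
theorem finiteDimensional_extendScalars {K₀ E : IntermediateField F Ω} (h : K₀ ≤ E) [FiniteDimensional F E] :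
    FiniteDimensional K₀ (extendScalars h) := by
  let l : ↥(extendScalars h) ≃ₗ[F] ↥E :=
    { toFun := fun x => ⟨x.1, x.2⟩
      invFun := fun y => ⟨y.1, y.2⟩
      left_inv := fun _ => rfl
      right_inv := fun _ => rfl
      map_add' := fun _ _ => rfl
      map_smul' := fun _ _ => rfl }
  haveI : FiniteDimensional F (extendScalars h) := LinearEquiv.finiteDimensional l.symm
  exact Module.Finite.of_restrictScalars_finite F K₀ _

/-- **Restriction of scalars `Gal(Ω/K₀) → Gal(Ω/F)` is continuous** for `K₀/F` finite (`Gal(Ω/E)` pulls back to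
`Gal(Ω/E·K₀)`). [cite: MochizukiFrdII2008, Thm 2.4 (ii) p.20] -/
theorem continuous_restrictScalarsHom (K₀ : IntermediateField F Ω) [FiniteDimensional F K₀] :
    Continuous (AlgEquiv.restrictScalarsHom F : (Ω ≃ₐ[K₀] Ω) →* (Ω ≃ₐ[F] Ω)) := by
  apply continuous_of_continuousAt_one (AlgEquiv.restrictScalarsHom F : (Ω ≃ₐ[K₀] Ω) →* (Ω ≃ₐ[F] Ω))
  rw [ContinuousAt, map_one]
  refine Filter.tendsto_def.mpr fun s hs => ?_
  obtain ⟨E, hE, hEs⟩ := (krullTopology_mem_nhds_one_iff F Ω s).mp hs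
  haveI := hE
  haveI : FiniteDimensional F ↥(E ⊔ K₀) := IntermediateField.finiteDimensional_sup E K₀
  refine (krullTopology_mem_nhds_one_iff K₀ Ω _).mpr
    ⟨extendScalars (le_sup_right : K₀ ≤ E ⊔ K₀), finiteDimensional_extendScalars _, ?_⟩
  intro σ hσ
  apply hEs
  rw [SetLike.mem_coe, IntermediateField.mem_fixingSubgroup_iff] at hσ ⊢
  intro x hx
  exact hσ x ((le_sup_left : E ≤ E ⊔ K₀) hx)

/-- Hence `Gal(Ω/K₀) ⥲ ↥(K₀.fixingSubgroup) ⊆ Gal(Ω/F)` (Mathlib `fixingSubgroupEquiv`, inverse direction) is continuous.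
[cite: MochizukiFrdII2008, Thm 2.4 (ii) p.20] -/
theorem continuous_fixingSubgroupEquiv_symm (K₀ : IntermediateField F Ω) [FiniteDimensional F K₀] :
    Continuous (fixingSubgroupEquiv K₀).symm :=
  (continuous_restrictScalarsHom K₀).subtype_mk _

/-! ### `Gal(K̄₀/K₀) ≅ Gal(Ω/K₀) ⊆ Gal(Ω/F)` through `ι : K̄₀ ≅ Ω` -/

variable (K₀ : IntermediateField F Ω) (ι : AlgebraicClosure K₀ ≃ₐ[K₀] Ω)

/-- The group isomorphism `Gal(K̄₀/K₀) ⥲ ↥(K₀.fixingSubgroup)`, `σ ↦ ι σ ι⁻¹`. [cite: MochizukiFrdII2008, Thm 2.4 (ii) p.20] -/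
def galConjMulEquiv : absoluteGaloisGroup K₀ ≃* ↥K₀.fixingSubgroup :=
  (AlgEquiv.autCongr ι).trans (fixingSubgroupEquiv K₀).symm

/-- Its values: `(ι σ ι⁻¹)(x) = ι(σ(ι⁻¹ x))`. [cite: MochizukiFrdII2008, Thm 2.4 (ii) p.20] -/
theorem coe_galConjMulEquiv_apply (σ : absoluteGaloisGroup K₀) (x : Ω) :
    ((galConjMulEquiv K₀ ι σ : ↥K₀.fixingSubgroup) : Ω ≃ₐ[F] Ω) x = ι (σ • ι.symm x) := rfl

variable [FiniteDimensional F K₀]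

/-- It is continuous. [cite: MochizukiFrdII2008, Thm 2.4 (ii) p.20] -/
theorem continuous_galConjMulEquiv : Continuous (galConjMulEquiv K₀ ι) :=
  (continuous_fixingSubgroupEquiv_symm K₀).comp (continuous_autCongr ι)

/-- **`Gal(K̄₀/K₀) ≅ ↥(K₀.fixingSubgroup)` as TOPOLOGICAL groups** (`σ ↦ ι σ ι⁻¹`; a continuous bijection from the compact
`Gal(K̄₀/K₀)` onto a Hausdorff group is a homeomorphism). [cite: MochizukiFrdII2008, Thm 2.4 (ii) p.20] -/
def galConj [CompactSpace (absoluteGaloisGroup K₀)] [Algebra.IsIntegral F Ω] :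
    absoluteGaloisGroup K₀ ≃ₜ* ↥K₀.fixingSubgroup :=
  haveI : T2Space (Ω ≃ₐ[F] Ω) := krullTopology_t2
  let eₜ : absoluteGaloisGroup K₀ ≃ₜ ↥K₀.fixingSubgroup :=
    (continuous_galConjMulEquiv K₀ ι).homeoOfEquivCompactToT2 (f := (galConjMulEquiv K₀ ι).toEquiv)
  { galConjMulEquiv K₀ ι with
    continuous_toFun := eₜ.continuous
    continuous_invFun := eₜ.symm.continuous }

/-- Values of `galConj`. [cite: MochizukiFrdII2008, Thm 2.4 (ii) p.20] -/
theorem coe_galConj_apply [CompactSpace (absoluteGaloisGroup K₀)] [Algebra.IsIntegral F Ω]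
    (σ : absoluteGaloisGroup K₀) (x : Ω) :
    ((galConj K₀ ι σ : ↥K₀.fixingSubgroup) : Ω ≃ₐ[F] Ω) x = ι (σ • ι.symm x) := rfl

/-- Values of `galConj⁻¹`: `(ι⁻¹ g ι)(y) = ι⁻¹(g(ι y))`. [cite: MochizukiFrdII2008, Thm 2.4 (ii) p.20] -/
theorem galConj_symm_apply_apply [CompactSpace (absoluteGaloisGroup K₀)] [Algebra.IsIntegral F Ω]
    (g : ↥K₀.fixingSubgroup) (y : AlgebraicClosure K₀) :
    (galConj K₀ ι).symm g • y = ι.symm ((g : Ω ≃ₐ[F] Ω) (ι y)) := by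
  have h := coe_galConj_apply K₀ ι ((galConj K₀ ι).symm g) (ι y)
  rw [ContinuousMulEquiv.apply_symm_apply, AlgEquiv.symm_apply_apply] at h
  rw [h, AlgEquiv.symm_apply_apply]

end GaloisConj

/-! ### §2: `G = Gal(K̄/K)` for `K = ℚ̄_p^{Im Π}` -/

namespace PadicFrd

namespace RelGal

open Field IntermediateField QuasiTemperoid GaloisConj

variable (p : ℕ) [Fact p.Prime] {P : Type} [Group P] [TopologicalSpace P]
  (φ₀ : P →* GalFbar ℚ_[p]) (hφ₀ : IsOpenHom φ₀)

/-- `Gal(K̄/K)` is compact (`K = ℚ̄_p^{Im Π}` has characteristic `0`, so `K̄/K` is Galois).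
[cite: MochizukiFrdII2008, Thm 2.4 (ii) p.20] -/
theorem compactSpace_absoluteGaloisGroup_baseFld : CompactSpace (absoluteGaloisGroup (baseFld p φ₀ hφ₀)) := by
  haveI : CharZero (baseFld p φ₀ hφ₀) :=
    charZero_of_injective_algebraMap (algebraMap ℚ_[p] (baseFld p φ₀ hφ₀)).injective
  haveI : IsGalois (baseFld p φ₀ hφ₀) (AlgebraicClosure (baseFld p φ₀ hφ₀)) := {}
  exact inferInstanceAs (CompactSpace (AlgebraicClosure (baseFld p φ₀ hφ₀) ≃ₐ[baseFld p φ₀ hφ₀]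
    AlgebraicClosure (baseFld p φ₀ hφ₀)))

/-- Membership in `Gal(ℚ̄_p/K)`: `g` fixes `K` iff `g = φ₀(π)` for some `π ∈ Π` (`Gal(ℚ̄_p/K) = Im(Π)`).
[cite: MochizukiFrdII2008, Def 2.2 p.17] -/
theorem mem_fixingSubgroup_baseFld_iff (g : GalFbar ℚ_[p]) :
    g ∈ (baseFld p φ₀ hφ₀).fixingSubgroup ↔ ∃ π : P, φ₀ π = g := by
  rw [fixingSubgroup_baseFld]
  exact mem_imGal p φ₀ hφ₀

/-- `φ₀ π ∈ Gal(ℚ̄_p/K)`. [cite: MochizukiFrdII2008, Def 2.2 p.17] -/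
theorem map_mem_fixingSubgroup_baseFld (π : P) : φ₀ π ∈ (baseFld p φ₀ hφ₀).fixingSubgroup :=
  (mem_fixingSubgroup_baseFld_iff p φ₀ hφ₀ _).mpr ⟨π, rfl⟩

/-- **"`G = Gal(K̄/K)`"**: `Gal(K̄/K) ≅ Gal(ℚ̄_p/K) = Im(Π) ⊆ G_{ℚ_p}` as topological groups, `σ ↦ ι σ ι⁻¹` through
`ι = closureEquiv` (`Gal(ℚ̄_p/K) = Im(Π)`: `mem_fixingSubgroup_baseFld_iff`). [cite: MochizukiFrdII2008, Def 2.2 p.17] -/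
def galConjBase : absoluteGaloisGroup (baseFld p φ₀ hφ₀) ≃ₜ* ↥(baseFld p φ₀ hφ₀).fixingSubgroup :=
  haveI := finiteDimensional_baseFld p φ₀ hφ₀
  haveI := compactSpace_absoluteGaloisGroup_baseFld p φ₀ hφ₀
  galConj (baseFld p φ₀ hφ₀) (closureEquiv p φ₀ hφ₀)

/-- Values of `galConjBase`: `(ι σ ι⁻¹)(x) = ι(σ(ι⁻¹ x))`. [cite: MochizukiFrdII2008, Def 2.2 p.17] -/
theorem coe_galConjBase_apply (σ : absoluteGaloisGroup (baseFld p φ₀ hφ₀)) (x : Fbar ℚ_[p]) :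
    ((galConjBase p φ₀ hφ₀ σ : ↥(baseFld p φ₀ hφ₀).fixingSubgroup) : GalFbar ℚ_[p]) x =
      closureEquiv p φ₀ hφ₀ (σ • (closureEquiv p φ₀ hφ₀).symm x) := rfl

/-- Values of `galConjBase⁻¹`. [cite: MochizukiFrdII2008, Def 2.2 p.17] -/
theorem galConjBase_symm_apply_apply (g : ↥(baseFld p φ₀ hφ₀).fixingSubgroup)
    (y : AlgebraicClosure (baseFld p φ₀ hφ₀)) :
    (galConjBase p φ₀ hφ₀).symm g • y =
      (closureEquiv p φ₀ hφ₀).symm ((g : GalFbar ℚ_[p]) (closureEquiv p φ₀ hφ₀ y)) :=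
  haveI := finiteDimensional_baseFld p φ₀ hφ₀
  haveI := compactSpace_absoluteGaloisGroup_baseFld p φ₀ hφ₀
  galConj_symm_apply_apply (baseFld p φ₀ hφ₀) (closureEquiv p φ₀ hφ₀) g y

end RelGal

end PadicFrd

end Literature.AlgebraicGeometry.Frobenioids

end
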